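import Literature.NumberTheory.ComplexMultiplication.WeilNumberPrimeInvariants
import HarnessLib

/-!
# Milne 1999 §5 (5.1): `ord_w(g(ϖ)) = h·Σ_{τw₀ = w} g(τ)`, hence `f_{g(ϖ)}(w) = Σ_{τw₀ = w} g(τ) ∈ ℤ` and `g(ϖ) ∈ W^K(p^{f(w₀/p)h})` —
# the prime invariants of the Weil numbers `g(ϖ)` of §5 «The map `P → S`», and `α^K` through `W^K`
# (J. S. Milne, *Lefschetz motives and the Tate conjecture*, Compositio Math. 117 (1999), §5 p. 63 L3–L7, display (5.1))

Family `hodge`, lane `lit-hodgefound` (Layer A3; seat `lit-hodgefound-p27`, generation 16, row g16-#2); topic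
`Literature/NumberTheory/ComplexMultiplication`, namespace `Literature.NumberTheory.ComplexMultiplication.CMNumbers`.  SEVENTH FILE of
the seat's Milne-1999 series; direct sequel of g16-#1 `WeilNumberPrimeInvariants` (`ord_w = primeOrd`, `Y = primesOverSet p K`,
`f_π(w) = fInv p n w π`, `W^K(pⁿ) = weilGroupIn K p n`, `fInvHom`, `toWeilGroup`) and of g15-#4/#5 `WeilTorusToSerreGroup(OfPrime)`
(`g(a) = serreCharEval g a ∈ (ℚ^{cm})ˣ`, `ϖ = primePowGenerator p 𝔭` with `(ϖ) = 𝔭^h`, `h = classOrder p 𝔭`, `Nm ϖ = p^{fh}`,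
`PPowNormElt.ofPrime`, `alphaUnit`, `alphaCharOfPrime = (g ↦ [g(ϖ)])`).  Here the Weil number `g(ϖ)` is produced INSIDE `K`
(`serreCharEvalIn`, for `K` normal over `ℚ`: `Hom(K, ℚ^{cm}) = τ₀ ∘ Gal(K/ℚ)`), its prime factorisation is computed — display (5.1) —
and `g ↦ g(ϖ)` is shown to land in `W^K(p^{fh})` (`alphaUnitIn`), recovering g15-#4's `alphaUnit` along `τ₀` and g15-#5's
`alphaCharOfPrime` on germs.  Small carriers with bodies (`embOfAut`/`autEquivEmb`, `serreCharEvalIn`, `basePrime`, `alphaUnitIn`)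
+ THEOREMS; no named fact (D-0026, net debt 0).

THE PRINT.  [Milne1999] §5 p. 63 L1–L9 (held `paper:doi-10-1023-a-1000776613765` p0019), verbatim: «Let `ϖ` generate the ideal
`𝔭_{w₀}^h`, where `h` is the order of the prime ideal `𝔭_{w₀}` corresponding to `w₀` in the class group of `K`. According to the
above remarks, `g(ϖ)` is independent of the choice of `ϖ` up to a root of unity, and it is a Weil `p^{f(𝔭_{w₀}/p)h}`-number of weight
`wt(g)`. Moreover, for any prime `w` of `K` lying over `p`, `ord_w(g(ϖ)) = h Σ_{τ, τw₀ = w} g(τ)`. Therefore, with the notation of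
Section 4, `f_{g(ϖ)}(w) = Σ_{τw₀ = w} g(τ) ∈ ℤ, (5.1)` and so `g(ϖ) ∈ W^K(p^{f(w₀/p)})`. The class it represents in `W^K(p^∞)` is
independent of the choice of `ϖ`, and so we have a homomorphism `g ↦ [g(ϖ)] : X^*(S^K) → W^K(p^∞)`.»  (Context, p. 62 L31–L34:
«Fix a CM-subfield `K` of `ℚ^{al}` of finite degree and Galois over `ℚ` and a prime `w₀` of `K` lying over `p`. … For
`g ∈ X^*(S^K)` and `a ∈ K`, define `g(a) = ∏_{τ : K → ℚ^{al}} (τa)^{g(τ)}`.»)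

DICTIONARY.  As in g15-#4/#5 and g16-#1: `K` a CM number field, here moreover NORMAL over `ℚ` where Milne's «Galois over `ℚ`» is
used (`[Normal ℚ K]`; a number field normal over `ℚ` is Galois); Milne's fixed `K ⊂ ℚ^{al}` is a chosen `τ₀ : K →ₐ[ℚ] ℚ^{cm}`, along
which `Hom(K, ℚ^{al}) = {τ₀ ∘ σ | σ ∈ Gal(K/ℚ)}` (`embOfAut τ₀ σ = τ₀ ∘ σ`, a bijection `autEquivEmb τ₀` for `K` normal — Mathlib
`Normal.algHomEquivAut`); Milne's `τ ∈ Gal(K/ℚ)` acting on the primes of `K` is `σ • w` (Mathlib's action of `Gal(K/ℚ)` on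
`Y = primesOverSet p K`, the `galRestrict` instance; `𝔭_{σw} = σ(𝔭_w)`), so that «`τw₀ = w`» reads `σ • w₀ = w` with
`w₀ = basePrime p 𝔭 = ⟨𝔭⟩ ∈ Y`, and the sum `Σ_{τw₀ = w} g(τ)` is `Σ_{σ ∈ Gal(K/ℚ), σ•w₀ = w} g(τ₀ ∘ σ)`.  Milne's `g(ϖ) ∈ K` (an
element of `ℚ^{al}` lying in the Galois subfield `K`) is `g_K(ϖ) = serreCharEvalIn τ₀ g ϖ = ∏_σ σ(ϖ)^{g(τ₀σ)} ∈ Kˣ`, with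
`τ₀(g_K(ϖ)) = g(ϖ)` = g15-#4's `serreCharEval g ϖ` (`map_serreCharEvalIn`).  `ord_w`, `f_π(w)`, `W^K(pⁿ)` are g16-#1's `primeOrd`,
`fInv`, `weilGroupIn`; `h = classOrder p 𝔭`, `f(𝔭_{w₀}/p) = (p).inertiaDeg' 𝔭`, the level `fh = primeLevel p 𝔭` (g15-#5).  The printed
target «`W^K(p^{f(w₀/p)})`» of the last clause is read as `W^K(p^{f(𝔭_{w₀}/p)h})`, the level of `g(ϖ)` stated two lines earlier («a Weil
`p^{f(𝔭_{w₀}/p)h}`-number») — for `h = 1` the two agree.  (5.1) is proved for EVERY CM field `K` and every function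
`g : Hom(K, ℚ^{cm}) → ℤ` (no Galois hypothesis, no weight condition: if no `σ` carries `w₀` to `w` both sides vanish; if some `σ`
does, `f(w/p) = f(w₀/p)`); the Weil-number clause needs `g ∈ X^*(S^K)` and `K` normal (to read `g(ϖ)` in `K`).

WHAT IS HERE (all PROVED):
* §1 DEF `embOfAut τ₀ σ = τ₀ ∘ σ` (`_apply/_one/_mul/_injective`), **`embOfAut_bijective`** (`K` normal), DEF **`autEquivEmb τ₀ :
  Gal(K/ℚ) ≃ Hom(K, ℚ^{cm})`**, `apply_autEquivEmb_symm`.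
* §2 DEF **`serreCharEvalIn τ₀ g : Kˣ →* Kˣ`, `a ↦ g_K(a) = ∏_σ σ(a)^{g(τ₀σ)}`**, `coe_serreCharEvalIn_apply`, `serreCharEvalIn_add/_zero`,
  **`map_serreCharEvalIn : τ₀(g_K(a)) = g(a)`** (`K` normal; reindex by `autEquivEmb`), `units_map_serreCharEvalIn`.
* §3 `w₀ = basePrime p 𝔭`, `multiplicity_prime_pow` (the multiplicity of a prime `v | p` in `𝔭^k` is `k·[v = 𝔭]`),
  **`primeOrd_primePowGenerator : ord_v(ϖ) = h·[v = w₀]`** (`(ϖ) = 𝔭^h`), **`primeOrd_smul_primePowGenerator` /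
  `primeOrd_algEquiv_primePowGenerator : ord_w(σϖ) = h·[σw₀ = w]`** (g16-#1 `primeOrd_smul`).
* §4 **(5.1)**: **`primeOrd_serreCharEvalIn_primePowGenerator : ord_w(g_K(ϖ)) = h·Σ_{σw₀ = w} g(τ₀σ)`**, `inertiaDeg_eq_of_smul_eq`
  (`f(w/p) = f(w₀/p)` for `w = σw₀`), **`fInv_serreCharEvalIn_primePowGenerator : f_{g_K(ϖ)}(w) = Σ_{σw₀ = w} g(τ₀σ)`** (level `fh`),
  `exists_smul_basePrime_eq` (for `K` Galois every `w ∈ Y` is some `σw₀` — Mathlib's transitivity `exists_smul_eq_of_isGaloisGroup`).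
* §5 (`K` CM and normal, `g ∈ X^*(S^K)`) **`isWeilNumberIn_serreCharEvalIn_primePowGenerator`** (`g_K(ϖ)` is a Weil `p^{fh}`-number of `K`
  of weight `wt(g)` — g15-#5 `isWeilNumber_serreCharEval_primePowGenerator` along `τ₀`), **`serreCharEvalIn_primePowGenerator_mem_weilGroupIn :
  g_K(ϖ) ∈ W^K(p^{fh})`** («and so `g(ϖ) ∈ W^K`»), DEF **`alphaUnitIn p 𝔭 τ₀ : X^*(S^K) → W^K(p^{fh})`, `g ↦ g_K(ϖ)`** (`coe_`, `_add`, `_zero`),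
  **`toWeilGroup_alphaUnitIn`** (`τ₀(g_K(ϖ)) = alphaUnit (ofPrime p 𝔭) g` — g15-#4's `g(ϖ) ∈ W(p^{fh})`), **`weilGerm_toWeilGroup_alphaUnitIn`**
  (`[τ₀ g_K(ϖ)] = alphaCharOfPrime p 𝔭 g = π(g)` — g15-#5), **`fInvHom_alphaUnitIn`** ((5.1) as the INTEGER-valued `f_{g(ϖ)} ∈ (Y → ℤ)`),
  **`alphaCharOfPrime_eq_iff`** (`π(g) = π(g′)` in `W(p^∞)` iff `Σ_{σw₀ = w} g(τ₀σ) = Σ_{σw₀ = w} g′(τ₀σ)` for all `w | p` — g16-#1's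
  injectivity `weilGerm_toWeilGroup_eq_iff` read through (5.1); the «second map is injective» step of Lemma 5.1).

NOT here: Lemma 5.1 / Remark 5.2 (a)(b) (surjectivity of `g ↦ f_{g(ϖ)}` onto `{f : Y → ℤ | f + ιf ∈ [K_w : ℚ_p]ℤ}`, injectivity of
`α^K`) — the next row; `W^K(p^∞)`, `P^K` as objects; Prop. 5.3 / Thm. 5.4 (Shimura–Taniyama — Layer B, B5-09).

## References

* [Milne1999] J. S. Milne, *Lefschetz motives and the Tate conjecture*, Compositio Math. 117 (1999) 45–76 — §5 «The map P → S»,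
  p. 62 L31 – p. 63 L9, display (5.1) (held `paper:doi-10-1023-a-1000776613765` p0018–p0019).
* [NeukirchANT1999] J. Neukirch, *Algebraic Number Theory*, Springer 1999 — Ch. I (8.2), Ch. II §8 p. 155 (prime decomposition and
  the `𝔭`-adic exponents; g16-#1's dictionary).
* [MilneCM2006] J. S. Milne, *Complex Multiplication* (course notes), Ch. I §4 Rem. 4.15 (`f(a) = ∏ φ(a)^{f(φ)}`; skel-3's files).

Provenance: lane `lit-hodgefound`, seat `lit-hodgefound-p27` gen 16 (agent `literature-prover-lit-hodgefound-p27-g16-0`),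
row g16-#2 (INBOX claim line of this row; g16-#1 = l.5854 / l.5938).
-/

set_option autoImplicit false

noncomputable section

open scoped NumberField Pointwise ComplexConjugate

namespace Literature.NumberTheory.ComplexMultiplication

namespace CMNumbers

open _root_.NumberField IsDedekindDomain
open Literature.NumberTheory.NumberFields (cmNumbers cmNumbersConj coe_cmNumbersConj)

variable {K : Type} [Field K] [NumberField K]

/-! ### §1 `Hom(K, ℚ^{cm}) = τ₀ ∘ Gal(K/ℚ)` for `K` normal over `ℚ` -/

/-- **`τ₀ ∘ σ`**: the embedding `K → ℚ^{cm}` obtained from the fixed one `τ₀` («Fix a CM-subfield `K` of `ℚ^{al}`») and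
`σ ∈ Gal(K/ℚ)` — Milne's identification of `τ : K → ℚ^{al}` with elements of `Gal(K/ℚ)`. [cite: Milne1999, §5 p. 62 L31–L34] -/
def embOfAut (τ₀ : K →ₐ[ℚ] cmNumbers) (σ : K ≃ₐ[ℚ] K) : K →ₐ[ℚ] cmNumbers := τ₀.comp (σ : K →ₐ[ℚ] K)

/-- [cite: Milne1999, §5 p. 62 L31–L34] -/
@[simp] theorem embOfAut_apply (τ₀ : K →ₐ[ℚ] cmNumbers) (σ : K ≃ₐ[ℚ] K) (x : K) : embOfAut τ₀ σ x = τ₀ (σ x) := rfl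

/-- `τ₀ ∘ 1 = τ₀`. [cite: Milne1999, §5 p. 62 L31–L34] -/
theorem embOfAut_one (τ₀ : K →ₐ[ℚ] cmNumbers) : embOfAut τ₀ 1 = τ₀ := AlgHom.ext fun _ => rfl

/-- `τ₀ ∘ (σσ′) = (τ₀ ∘ σ) ∘ σ′`. [cite: Milne1999, §5 p. 62 L31–L34] -/
theorem embOfAut_mul (τ₀ : K →ₐ[ℚ] cmNumbers) (σ σ' : K ≃ₐ[ℚ] K) : embOfAut τ₀ (σ * σ') = embOfAut (embOfAut τ₀ σ) σ' :=
  AlgHom.ext fun _ => rfl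

/-- `σ ↦ τ₀ ∘ σ` is injective. [cite: Milne1999, §5 p. 62 L31–L34] -/
theorem embOfAut_injective (τ₀ : K →ₐ[ℚ] cmNumbers) : Function.Injective (embOfAut τ₀) := by
  intro σ σ' h
  ext x
  exact τ₀.toRingHom.injective (by simpa using AlgHom.congr_fun h x)

/-- **For `K` normal over `ℚ`, `σ ↦ τ₀ ∘ σ : Gal(K/ℚ) → Hom(K, ℚ^{cm})` is a BIJECTION** (Mathlib `Normal.algHomEquivAut`, with
`ℚ^{cm}` a `K`-algebra through `τ₀`). [cite: Milne1999, §5 p. 62 L31–L34 («K … Galois over ℚ»)] -/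
theorem embOfAut_bijective [Normal ℚ K] (τ₀ : K →ₐ[ℚ] cmNumbers) : Function.Bijective (embOfAut τ₀) := by
  letI : Algebra K cmNumbers := τ₀.toRingHom.toAlgebra
  haveI : IsScalarTower ℚ K cmNumbers := IsScalarTower.of_algebraMap_eq fun x => (τ₀.commutes x).symm
  have h : embOfAut τ₀ = (Normal.algHomEquivAut ℚ cmNumbers K).symm := by
    funext σ
    ext x
    rfl
  rw [h]
  exact (Normal.algHomEquivAut ℚ cmNumbers K).symm.bijective

/-- **`Gal(K/ℚ) ≃ Hom(K, ℚ^{cm})`, `σ ↦ τ₀ ∘ σ`** (`K` normal over `ℚ`). [cite: Milne1999, §5 p. 62 L31–L34] -/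
def autEquivEmb [Normal ℚ K] (τ₀ : K →ₐ[ℚ] cmNumbers) : (K ≃ₐ[ℚ] K) ≃ (K →ₐ[ℚ] cmNumbers) :=
  Equiv.ofBijective (embOfAut τ₀) (embOfAut_bijective τ₀)

/-- [cite: Milne1999, §5 p. 62 L31–L34] -/
@[simp] theorem autEquivEmb_apply [Normal ℚ K] (τ₀ : K →ₐ[ℚ] cmNumbers) (σ : K ≃ₐ[ℚ] K) :
    autEquivEmb τ₀ σ = embOfAut τ₀ σ := rfl

/-- `τ₀ ∘ (τ₀⁻¹τ) = τ`. [cite: Milne1999, §5 p. 62 L31–L34] -/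
theorem apply_autEquivEmb_symm [Normal ℚ K] (τ₀ τ : K →ₐ[ℚ] cmNumbers) (x : K) : τ₀ ((autEquivEmb τ₀).symm τ x) = τ x :=
  AlgHom.congr_fun ((autEquivEmb τ₀).apply_symm_apply τ) x

/-! ### §2 `g_K(a) = ∏_σ σ(a)^{g(τ₀σ)} ∈ Kˣ`: the Weil numbers `g(a)` read inside `K` -/

/-- **`g_K(a) = ∏_{σ ∈ Gal(K/ℚ)} σ(a)^{g(τ₀ ∘ σ)} ∈ Kˣ`** for `g : Hom(K, ℚ^{cm}) → ℤ` and `a ∈ Kˣ` — Milne's `g(a) = ∏_{τ : K → ℚ^{al}} (τa)^{g(τ)}`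
as an element of the Galois subfield `K ⊂ ℚ^{al}` (for `K` normal `τ₀(g_K(a)) = g(a)`, `map_serreCharEvalIn`); a homomorphism in `a`.
[cite: Milne1999, §5 p. 62 L33–L34] -/
def serreCharEvalIn (τ₀ : K →ₐ[ℚ] cmNumbers) (g : (K →ₐ[ℚ] cmNumbers) → ℤ) : Kˣ →* Kˣ where
  toFun a := ∏ σ : K ≃ₐ[ℚ] K, Units.map (σ : K →* K) a ^ g (embOfAut τ₀ σ)
  map_one' := by simp
  map_mul' a b := by simp only [map_mul, mul_zpow, Finset.prod_mul_distrib]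

/-- Unfolding `g_K(a)` in `Kˣ`. [cite: Milne1999, §5 p. 62 L33–L34] -/
theorem serreCharEvalIn_apply (τ₀ : K →ₐ[ℚ] cmNumbers) (g : (K →ₐ[ℚ] cmNumbers) → ℤ) (a : Kˣ) :
    serreCharEvalIn τ₀ g a = ∏ σ : K ≃ₐ[ℚ] K, Units.map (σ : K →* K) a ^ g (embOfAut τ₀ σ) := rfl

/-- **`g_K(a) = ∏_σ σ(a)^{g(τ₀σ)}` in `K`.** [cite: Milne1999, §5 p. 62 L33–L34] -/
theorem coe_serreCharEvalIn_apply (τ₀ : K →ₐ[ℚ] cmNumbers) (g : (K →ₐ[ℚ] cmNumbers) → ℤ) (a : Kˣ) :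
    ((serreCharEvalIn τ₀ g a : Kˣ) : K) = ∏ σ : K ≃ₐ[ℚ] K, σ (a : K) ^ g (embOfAut τ₀ σ) := by
  rw [serreCharEvalIn_apply, Units.coe_prod]
  refine Finset.prod_congr rfl fun σ _ => ?_
  rw [Units.val_zpow_eq_zpow_val, Units.coe_map, MonoidHom.coe_coe]

/-- `(g + g′)_K(a) = g_K(a)·g′_K(a)`. [cite: Milne1999, §5 p. 63 L7–L8 («a homomorphism g ↦ [g(ϖ)]»)] -/
theorem serreCharEvalIn_add (τ₀ : K →ₐ[ℚ] cmNumbers) (g g' : (K →ₐ[ℚ] cmNumbers) → ℤ) :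
    serreCharEvalIn τ₀ (g + g') = serreCharEvalIn τ₀ g * serreCharEvalIn τ₀ g' := by
  ext a : 1
  simp only [MonoidHom.mul_apply, serreCharEvalIn_apply, Pi.add_apply, zpow_add, Finset.prod_mul_distrib]

/-- `0_K(a) = 1`. [cite: Milne1999, §5 p. 63 L7–L8] -/
theorem serreCharEvalIn_zero (τ₀ : K →ₐ[ℚ] cmNumbers) : serreCharEvalIn τ₀ (0 : (K →ₐ[ℚ] cmNumbers) → ℤ) = 1 := by
  ext a : 1
  simp [serreCharEvalIn_apply]

/-- **`τ₀(g_K(a)) = g(a)`** for `K` normal over `ℚ`: reindex `∏_σ τ₀(σa)^{g(τ₀σ)}` along `autEquivEmb τ₀` to g15-#4's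
`g(a) = ∏_τ τ(a)^{g(τ)} = serreCharEval g a`. [cite: Milne1999, §5 p. 62 L33–L34] -/
theorem map_serreCharEvalIn [Normal ℚ K] (τ₀ : K →ₐ[ℚ] cmNumbers) (g : (K →ₐ[ℚ] cmNumbers) → ℤ) (a : Kˣ) :
    τ₀ ((serreCharEvalIn τ₀ g a : Kˣ) : K) = ((serreCharEval g a : cmNumbersˣ) : cmNumbers) := by
  rw [coe_serreCharEvalIn_apply, coe_serreCharEval_apply, map_prod]
  simp_rw [map_zpow₀]
  exact Fintype.prod_equiv (autEquivEmb τ₀) _ _ fun σ => rfl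

/-- `τ₀(g_K(a)) = g(a)` in `(ℚ^{cm})ˣ`. [cite: Milne1999, §5 p. 62 L33–L34] -/
theorem units_map_serreCharEvalIn [Normal ℚ K] (τ₀ : K →ₐ[ℚ] cmNumbers) (g : (K →ₐ[ℚ] cmNumbers) → ℤ) (a : Kˣ) :
    Units.map (τ₀ : K →* cmNumbers) (serreCharEvalIn τ₀ g a) = serreCharEval g a :=
  Units.ext (map_serreCharEvalIn τ₀ g a)

/-! ### §3 `ord_v(ϖ) = h·[v = w₀]` and `ord_w(σϖ) = h·[σw₀ = w]` -/

section OrdGenerator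

variable (p : ℕ) [hp : Fact p.Prime] (𝔭 : Ideal (𝓞 K)) [h𝔭 : 𝔭.LiesOver (Ideal.span {(p : ℤ)})] [h𝔭P : 𝔭.IsPrime]

/-- **`w₀ ∈ Y`**: the fixed prime `𝔭 = 𝔭_{w₀}` of `K` over `p` as an element of g16-#1's `Y = primesOverSet p K` («Fix … a prime `w₀` of
`K` lying over `p`»). [cite: Milne1999, §5 p. 62 L31–L32] -/
abbrev basePrime : primesOverSet p K := ⟨𝔭, h𝔭P, h𝔭⟩

/-- The multiplicity of a prime `v | p` in `𝔭^k` is `k` if `v = 𝔭` and `0` otherwise (distinct non-zero primes of the Dedekind domain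
`𝓞_K` are coprime). [cite: NeukirchANT1999, Ch. II §8 p. 155 («(a) = ∏ 𝔭^{v_𝔭}»)] -/
theorem multiplicity_prime_pow (v : primesOverSet p K) (k : ℕ) :
    multiplicity v.1 (𝔭 ^ k) = if v.1 = 𝔭 then k else 0 := by
  have h𝔭0 : 𝔭 ≠ ⊥ := ne_bot_of_liesOver p 𝔭
  have hv0 : v.1 ≠ ⊥ := ne_bot_of_liesOver p v.1
  have hprime : Prime 𝔭 := Ideal.prime_of_isPrime h𝔭0 h𝔭P
  split_ifs with h
  · rw [h]
    exact multiplicity_pow_self_of_prime hprime k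
  · refine multiplicity_eq_zero.mpr fun hdvd => h ?_
    have hvprime : Prime v.1 := Ideal.prime_of_isPrime hv0 v.2.1
    have h1 : v.1 ∣ 𝔭 := hvprime.dvd_of_dvd_pow hdvd
    haveI := Ideal.IsPrime.isMaximal h𝔭P h𝔭0
    exact (Ideal.IsMaximal.eq_of_le inferInstance v.2.1.ne_top (Ideal.le_of_dvd h1)).symm

/-- **`ord_v(ϖ) = h` if `v = w₀`, `= 0` at every other prime `v | p`** — since `(ϖ) = 𝔭_{w₀}^h` (g15-#5 `span_primePowGenerator`) and
`ord_v` is the exponent in the factorisation (g16-#1 `primeOrd_algebraMap`). [cite: Milne1999, §5 p. 63 L1–L4] -/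
theorem primeOrd_primePowGenerator (v : primesOverSet p K) :
    primeOrd (toSpectrum p v) ((primePowGenerator p 𝔭 : 𝓞 K) : K) = if v.1 = 𝔭 then (classOrder p 𝔭 : ℤ) else 0 := by
  rw [primeOrd_algebraMap (toSpectrum p v) (primePowGenerator_ne_zero p 𝔭), span_primePowGenerator, toSpectrum_asIdeal,
    multiplicity_prime_pow]
  split_ifs <;> simp

/-- **`ord_w(σϖ) = h·[σw₀ = w]`** for `σ` in any group `G` acting on `K` by ring automorphisms (pointwise action on `Y`): `ord_w(σϖ) =
ord_{σ⁻¹w}(ϖ)` (g16-#1 `primeOrd_smul`) and `σ⁻¹w = w₀ ⟺ σw₀ = w`. [cite: Milne1999, §5 p. 63 L3–L4 («ord_w(g(ϖ)) = h Σ_{τw₀ = w} g(τ)»)] -/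
theorem primeOrd_smul_primePowGenerator {G : Type*} [Group G] [MulSemiringAction G K] [SMulCommClass G ℤ (𝓞 K)]
    (σ : G) (w : primesOverSet p K) :
    primeOrd (toSpectrum p w) (σ • ((primePowGenerator p 𝔭 : 𝓞 K) : K)) =
      if σ • basePrime p 𝔭 = w then (classOrder p 𝔭 : ℤ) else 0 := by
  have hw : w = σ • (σ⁻¹ • w) := (smul_inv_smul σ w).symm
  have h1 := primeOrd_smul σ (x := ((primePowGenerator p 𝔭 : 𝓞 K) : K)) (toSpectrum p (σ⁻¹ • w)) (toSpectrum p w)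
    ((congrArg (fun v => (toSpectrum p v).asIdeal) hw).trans (toSpectrum_smul p σ _))
  rw [h1, primeOrd_primePowGenerator]
  have key : ((σ⁻¹ • w).1 = 𝔭) ↔ (σ • basePrime p 𝔭 = w) := by
    constructor
    · intro h
      have h' : σ⁻¹ • w = basePrime p 𝔭 := Subtype.ext h
      rw [← h', smul_inv_smul]
    · intro h
      rw [← h, inv_smul_smul]
  by_cases hc : σ • basePrime p 𝔭 = w
  · rw [if_pos hc, if_pos (key.mpr hc)]
  · rw [if_neg hc, if_neg fun h => hc (key.mp h)]

/-- **`ord_w(σϖ) = h·[σw₀ = w]` for `σ ∈ Gal(K/ℚ)`** (Mathlib's `galRestrict` spelling of `σw`, = the pointwise one by g16-#1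
`algEquiv_smul_primesOver_eq`). [cite: Milne1999, §5 p. 63 L3–L4] -/
theorem primeOrd_algEquiv_primePowGenerator (σ : K ≃ₐ[ℚ] K) (w : primesOverSet p K) :
    primeOrd (toSpectrum p w) (σ ((primePowGenerator p 𝔭 : 𝓞 K) : K)) =
      if σ • basePrime p 𝔭 = w then (classOrder p 𝔭 : ℤ) else 0 := by
  rw [algEquiv_smul_primesOver_eq]
  exact primeOrd_smul_primePowGenerator p 𝔭 σ w

/-! ### §4 Display (5.1): `ord_w(g(ϖ)) = h·Σ_{τw₀ = w} g(τ)` and `f_{g(ϖ)}(w) = Σ_{τw₀ = w} g(τ)` -/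

variable (τ₀ : K →ₐ[ℚ] cmNumbers) (g : (K →ₐ[ℚ] cmNumbers) → ℤ)

/-- **«for any prime `w` of `K` lying over `p`, `ord_w(g(ϖ)) = h Σ_{τ, τw₀ = w} g(τ)`»** — for `g_K(ϖ) = ∏_σ σ(ϖ)^{g(τ₀σ)}`:
`ord_w(g_K(ϖ)) = Σ_σ g(τ₀σ)·ord_w(σϖ) = h·Σ_{σw₀ = w} g(τ₀σ)` (any CM `K`, any `g`). [cite: Milne1999, §5 p. 63 L3–L4] -/
theorem primeOrd_serreCharEvalIn_primePowGenerator [IsCMField K] (w : primesOverSet p K) :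
    primeOrd (toSpectrum p w) ((serreCharEvalIn τ₀ g (PPowNormElt.ofPrime p 𝔭).unit : Kˣ) : K) =
      classOrder p 𝔭 * ∑ σ ∈ Finset.univ.filter (fun σ : K ≃ₐ[ℚ] K => σ • basePrime p 𝔭 = w), g (embOfAut τ₀ σ) := by
  classical
  have hϖ : ∀ σ : K ≃ₐ[ℚ] K, σ ((PPowNormElt.ofPrime p 𝔭).unit : K) ≠ 0 := fun σ =>
    (map_ne_zero σ).mpr (PPowNormElt.ofPrime p 𝔭).unit.ne_zero
  rw [coe_serreCharEvalIn_apply, primeOrd_prod _ _ _ fun σ _ => zpow_ne_zero _ (hϖ σ)]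
  simp_rw [primeOrd_zpow, PPowNormElt.coe_unit, PPowNormElt.ofPrime_elt, primeOrd_algEquiv_primePowGenerator, mul_ite, mul_zero,
    Finset.sum_ite, Finset.sum_const_zero, add_zero, Finset.mul_sum]
  refine Finset.sum_congr rfl fun σ _ => mul_comm _ _

omit h𝔭P in
/-- `pℤ` is a maximal ideal of `ℤ`. [cite: NeukirchANT1999, Ch. I (8.2)] -/
private theorem isMaximal_span_natCast' : (Ideal.span {(p : ℤ)}).IsMaximal :=
  Ideal.IsPrime.isMaximal ((Ideal.span_singleton_prime (Int.natCast_ne_zero.mpr hp.out.ne_zero)).mpr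
    (Nat.prime_iff_prime_int.mp hp.out)) (by simpa using hp.out.ne_zero)

/-- Conjugate primes have the same residue degree: `f(σw₀/p) = f(w₀/p)` (Mathlib `inertiaDeg_smul`; g15-#5 writes `f(𝔭_{w₀}/p)` as
`inertiaDeg'`). [cite: NeukirchANT1999, Ch. II §8 p. 155] [cite: Milne1999, §5 p. 63 L4–L5 («with the notation of Section 4»)] -/
theorem inertiaDeg_eq_of_smul_eq (σ : K ≃ₐ[ℚ] K) (w : primesOverSet p K) (h : σ • basePrime p 𝔭 = w) :
    (w.1.inertiaDeg ℤ : ℤ) = (Ideal.span {(p : ℤ)}).inertiaDeg' 𝔭 := by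
  haveI := isMaximal_span_natCast' p
  haveI : 𝔭.IsMaximal := Ideal.IsPrime.isMaximal h𝔭P (ne_bot_of_liesOver p 𝔭)
  rw [Ideal.inertiaDeg'_eq_inertiaDeg, ← h, coe_algEquiv_smul_primesOver, Ideal.inertiaDeg_smul]

/-- **DISPLAY (5.1): «`f_{g(ϖ)}(w) = Σ_{τw₀ = w} g(τ) ∈ ℤ`»** at the level `p^{f(𝔭_{w₀}/p)h}` of `g(ϖ)`:
`f = ord_w(g_K(ϖ))·f(w/p)/(f(w₀/p)h) = h·Σ·f(w/p)/(f(w₀/p)·h) = Σ_{σw₀ = w} g(τ₀σ)` (if some `σ` carries `w₀` to `w` then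
`f(w/p) = f(w₀/p)`; otherwise both sides vanish — so no Galois hypothesis is needed). [cite: Milne1999, §5 p. 63 L4–L6, display (5.1)] -/
theorem fInv_serreCharEvalIn_primePowGenerator [IsCMField K] (w : primesOverSet p K) :
    fInv p (primeLevel p 𝔭) w ((serreCharEvalIn τ₀ g (PPowNormElt.ofPrime p 𝔭).unit : Kˣ) : K) =
      ∑ σ ∈ Finset.univ.filter (fun σ : K ≃ₐ[ℚ] K => σ • basePrime p 𝔭 = w), g (embOfAut τ₀ σ) := by
  classical
  rw [fInv_eq_div, primeOrd_serreCharEvalIn_primePowGenerator, coe_primeLevel]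
  by_cases hS : ∃ σ : K ≃ₐ[ℚ] K, σ • basePrime p 𝔭 = w
  · obtain ⟨σ, hσ⟩ := hS
    have hf : ((w.1.inertiaDeg ℤ : ℕ) : ℚ) = ((Ideal.span {(p : ℤ)}).inertiaDeg' 𝔭 : ℚ) := by
      exact_mod_cast inertiaDeg_eq_of_smul_eq p 𝔭 σ w hσ
    have hf0 : ((Ideal.span {(p : ℤ)}).inertiaDeg' 𝔭 : ℚ) ≠ 0 := by
      exact_mod_cast (Ideal.inertiaDeg'_pos' (Ideal.span {(p : ℤ)}) 𝔭).ne'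
    have hh0 : (classOrder p 𝔭 : ℚ) ≠ 0 := by exact_mod_cast (classOrder_pos p 𝔭).ne'
    rw [hf]
    push_cast
    field_simp
  · have hempty : Finset.univ.filter (fun σ : K ≃ₐ[ℚ] K => σ • basePrime p 𝔭 = w) = ∅ :=
      Finset.filter_eq_empty_iff.mpr fun σ _ h => hS ⟨σ, h⟩
    rw [hempty, Finset.sum_empty]
    simp

omit hp in
/-- For `K` GALOIS over `ℚ` every prime `w | p` is `σw₀` for some `σ ∈ Gal(K/ℚ)` (Mathlib `exists_smul_eq_of_isGaloisGroup`), so the sums in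
(5.1) run over cosets of the decomposition group. [cite: Milne1999, §5 p. 63 L12–L13 («the map τ ↦ τw₀ : Gal(K/ℚ) → Y»)] -/
theorem exists_smul_basePrime_eq [IsGalois ℚ K] (w : primesOverSet p K) : ∃ σ : K ≃ₐ[ℚ] K, σ • basePrime p 𝔭 = w := by
  obtain ⟨σ, hσ⟩ := Ideal.exists_smul_eq_of_isGaloisGroup (Ideal.span {(p : ℤ)}) 𝔭 w.1 (K ≃ₐ[ℚ] K)
  refine ⟨σ, Subtype.ext ?_⟩
  rw [coe_algEquiv_smul_primesOver]
  exact hσ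

/-! ### §5 «and so `g(ϖ) ∈ W^K(p^{f(w₀/p)h})`»: `α^K` through `W^K` -/

variable [IsCMField K]

/-- **`g_K(ϖ)` is a Weil `p^{f(𝔭_{w₀}/p)h}`-number of `K` of weight `wt(g)`** for `g ∈ X^*(S^K)` (`K` normal): along `τ₀` it is g15-#5's
`g(ϖ)` (`map_serreCharEvalIn`, `isWeilNumber_serreCharEval_primePowGenerator`, g16-#1 `isWeilNumberIn_iff`). [cite: Milne1999, §5 p. 63 L2–L3] -/
theorem isWeilNumberIn_serreCharEvalIn_primePowGenerator [Normal ℚ K]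
    (hg : g ∈ infinityTypes (cmNumbers ≃ₐ[ℚ] cmNumbers) (K →ₐ[ℚ] cmNumbers) cmNumbersConj) :
    IsWeilNumberIn p ((Ideal.span {(p : ℤ)}).inertiaDeg' 𝔭 * classOrder p 𝔭) (-weight cmNumbersConj τ₀ g)
      ((serreCharEvalIn τ₀ g (PPowNormElt.ofPrime p 𝔭).unit : Kˣ) : K) := by
  rw [isWeilNumberIn_iff τ₀, map_serreCharEvalIn]
  exact isWeilNumber_serreCharEval_primePowGenerator p 𝔭 hg τ₀

/-- **«and so `g(ϖ) ∈ W^K(p^{f(w₀/p)h})`»**: a Weil `p^{fh}`-number of `K` whose `f`-values `Σ_{σw₀ = w} g(τ₀σ)` are integers by (5.1)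
(g16-#1 `weilGroupIn`). [cite: Milne1999, §5 p. 63 L5–L6] -/
theorem serreCharEvalIn_primePowGenerator_mem_weilGroupIn [Normal ℚ K]
    (hg : g ∈ infinityTypes (cmNumbers ≃ₐ[ℚ] cmNumbers) (K →ₐ[ℚ] cmNumbers) cmNumbersConj) :
    serreCharEvalIn τ₀ g (PPowNormElt.ofPrime p 𝔭).unit ∈ weilGroupIn K p (primeLevel p 𝔭) := by
  classical
  refine ⟨⟨_, isWeilNumberIn_serreCharEvalIn_primePowGenerator p 𝔭 τ₀ g hg⟩, fun w =>
    ⟨∑ σ ∈ Finset.univ.filter (fun σ : K ≃ₐ[ℚ] K => σ • basePrime p 𝔭 = w), g (embOfAut τ₀ σ), ?_⟩⟩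
  rw [fInv_serreCharEvalIn_primePowGenerator, Int.cast_sum]

/-- **`g ↦ g_K(ϖ) : X^*(S^K) → W^K(p^{f(𝔭_{w₀}/p)h})`** — Milne's `g ↦ g(ϖ)` with target `W^K` (g16-#1 `weilGroupIn`), for `K` CM and normal.
[cite: Milne1999, §5 p. 63 L5–L8 («g(ϖ) ∈ W^K … a homomorphism g ↦ [g(ϖ)] : X^*(S^K) → W^K(p^∞)»)] -/
def alphaUnitIn [Normal ℚ K] (g : infinityTypes (cmNumbers ≃ₐ[ℚ] cmNumbers) (K →ₐ[ℚ] cmNumbers) cmNumbersConj) :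
    weilGroupIn K p (primeLevel p 𝔭) :=
  ⟨serreCharEvalIn τ₀ (g : (K →ₐ[ℚ] cmNumbers) → ℤ) (PPowNormElt.ofPrime p 𝔭).unit,
    serreCharEvalIn_primePowGenerator_mem_weilGroupIn p 𝔭 τ₀ g g.2⟩

/-- `alphaUnitIn g = g_K(ϖ)` in `Kˣ`. [cite: Milne1999, §5 p. 63 L5–L8] -/
@[simp] theorem coe_alphaUnitIn [Normal ℚ K] (g : infinityTypes (cmNumbers ≃ₐ[ℚ] cmNumbers) (K →ₐ[ℚ] cmNumbers) cmNumbersConj) :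
    ((alphaUnitIn p 𝔭 τ₀ g : weilGroupIn K p (primeLevel p 𝔭)) : Kˣ) =
      serreCharEvalIn τ₀ (g : (K →ₐ[ℚ] cmNumbers) → ℤ) (PPowNormElt.ofPrime p 𝔭).unit := rfl

/-- `(g + g′)_K(ϖ) = g_K(ϖ)·g′_K(ϖ)` in `W^K` («a homomorphism»). [cite: Milne1999, §5 p. 63 L7–L8] -/
theorem alphaUnitIn_add [Normal ℚ K] (g g' : infinityTypes (cmNumbers ≃ₐ[ℚ] cmNumbers) (K →ₐ[ℚ] cmNumbers) cmNumbersConj) :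
    alphaUnitIn p 𝔭 τ₀ (g + g') = alphaUnitIn p 𝔭 τ₀ g * alphaUnitIn p 𝔭 τ₀ g' :=
  Subtype.ext (by rw [coe_alphaUnitIn, Submodule.coe_add, serreCharEvalIn_add, MonoidHom.mul_apply]; rfl)

/-- `0_K(ϖ) = 1`. [cite: Milne1999, §5 p. 63 L7–L8] -/
theorem alphaUnitIn_zero [Normal ℚ K] : alphaUnitIn p 𝔭 τ₀ 0 = 1 :=
  Subtype.ext (by rw [coe_alphaUnitIn, Submodule.coe_zero, serreCharEvalIn_zero, MonoidHom.one_apply]; rfl)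

/-- **Along `τ₀`, `g_K(ϖ)` IS g15-#4's `g(ϖ) ∈ W(p^{fh})`**: `toWeilGroup τ₀ (alphaUnitIn g) = alphaUnit (ofPrime p 𝔭) g` — Milne's
`W^K(p^{fh}) ⊂ W(p^{fh})`. [cite: Milne1999, §5 p. 63 L5–L8] [cite: Milne1999, §4 p. 61 L20–L21 («a Γ-submodule of W(p^∞)»)] -/
theorem toWeilGroup_alphaUnitIn [Normal ℚ K] (g : infinityTypes (cmNumbers ≃ₐ[ℚ] cmNumbers) (K →ₐ[ℚ] cmNumbers) cmNumbersConj) :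
    toWeilGroup τ₀ (alphaUnitIn p 𝔭 τ₀ g) = alphaUnit (Or.inr ‹IsCMField K›) (PPowNormElt.ofPrime p 𝔭) g :=
  Subtype.ext (by rw [coe_alphaUnit]; exact units_map_serreCharEvalIn τ₀ _ _)

/-- **On germs: `[τ₀ g_K(ϖ)] = π(g) = alphaCharOfPrime p 𝔭 g ∈ W(p^∞)`** (g15-#5's canonical `g ↦ [g(ϖ)]`).
[cite: Milne1999, §5 p. 63 L6–L8 («we have a homomorphism g ↦ [g(ϖ)] … We sometimes denote this map as g ↦ π(g)»)] -/
theorem weilGerm_toWeilGroup_alphaUnitIn [Normal ℚ K]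
    (g : infinityTypes (cmNumbers ≃ₐ[ℚ] cmNumbers) (K →ₐ[ℚ] cmNumbers) cmNumbersConj) :
    weilGerm (primeLevel p 𝔭) (toWeilGroup τ₀ (alphaUnitIn p 𝔭 τ₀ g)) = Additive.toMul (alphaCharOfPrime p 𝔭 g) := by
  rw [toWeilGroup_alphaUnitIn, alphaCharOfPrime_apply, toMul_ofMul]

/-- **(5.1) for the INTEGER invariants of g16-#1**: `fInvHom (g_K(ϖ)) (w) = Σ_{σw₀ = w} g(τ₀σ)`. [cite: Milne1999, §5 p. 63 display (5.1)] -/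
theorem fInvHom_alphaUnitIn [Normal ℚ K] (g : infinityTypes (cmNumbers ≃ₐ[ℚ] cmNumbers) (K →ₐ[ℚ] cmNumbers) cmNumbersConj)
    (w : primesOverSet p K) :
    (fInvHom (alphaUnitIn p 𝔭 τ₀ g)).toAdd w =
      ∑ σ ∈ Finset.univ.filter (fun σ : K ≃ₐ[ℚ] K => σ • basePrime p 𝔭 = w), (g : (K →ₐ[ℚ] cmNumbers) → ℤ) (embOfAut τ₀ σ) := by
  classical
  have h := fInvHom_apply (alphaUnitIn p 𝔭 τ₀ g) w
  rw [coe_alphaUnitIn, fInv_serreCharEvalIn_primePowGenerator] at h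
  exact_mod_cast h

/-- **`π(g) = π(g′)` in `W(p^∞)` iff `Σ_{σw₀ = w} g(τ₀σ) = Σ_{σw₀ = w} g′(τ₀σ)` for every `w | p`** — g16-#1's injectivity of
`[π] ↦ f_π` (`weilGerm_toWeilGroup_eq_iff`) combined with (5.1): the kernel of `g ↦ π(g)` is read off the fibre sums (the
injective second map of Lemma 5.1). [cite: Milne1999, §5 p. 63 display (5.1), L11–L12 («the second map is injective»)] -/
theorem alphaCharOfPrime_eq_iff [Normal ℚ K] (g g' : infinityTypes (cmNumbers ≃ₐ[ℚ] cmNumbers) (K →ₐ[ℚ] cmNumbers) cmNumbersConj) :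
    alphaCharOfPrime p 𝔭 g = alphaCharOfPrime p 𝔭 g' ↔
      ∀ w : primesOverSet p K,
        ∑ σ ∈ Finset.univ.filter (fun σ : K ≃ₐ[ℚ] K => σ • basePrime p 𝔭 = w), (g : (K →ₐ[ℚ] cmNumbers) → ℤ) (embOfAut τ₀ σ) =
        ∑ σ ∈ Finset.univ.filter (fun σ : K ≃ₐ[ℚ] K => σ • basePrime p 𝔭 = w), (g' : (K →ₐ[ℚ] cmNumbers) → ℤ) (embOfAut τ₀ σ) := by
  classical
  rw [← Additive.toMul.injective.eq_iff, ← weilGerm_toWeilGroup_alphaUnitIn p 𝔭 τ₀ g, ← weilGerm_toWeilGroup_alphaUnitIn p 𝔭 τ₀ g',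
    weilGerm_toWeilGroup_eq_iff]
  refine forall_congr' fun w => ?_
  rw [coe_alphaUnitIn, coe_alphaUnitIn, fInv_serreCharEvalIn_primePowGenerator, fInv_serreCharEvalIn_primePowGenerator]
  exact_mod_cast Iff.rfl

end OrdGenerator

end CMNumbers

end Literature.NumberTheory.ComplexMultiplication

end
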